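import Literature.Geometry.Kaehler.MilnorSymbolCocycleTransgression
import Literature.Geometry.Kaehler.CechDeRhamTransgressionPullback
import Literature.AlgebraicGeometry.HodgeTheory.SymbolClasses
import Literature.AlgebraicGeometry.HodgeTheory.HodgeTypePullbackVanishing
import Literature.AlgebraicGeometry.HodgeTheory.GysinFormalism
import Literature.NumberTheory.Transcendental.ComplexFormsPullback
import HarnessLib

/-!
# Symbol classes pull back: Milnor cocycles, symbol forms and `HasSymbolCocycle` under endomorphisms

"Units pull back": along a holomorphic map `f : N → M`, an invertible holomorphic function on `W`
becomes one on `f⁻¹(W)`, the naive Milnor relations over `W` map into those over `f⁻¹(W)`, a Čech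
cocycle of Milnor symbols on the cover `𝔘` becomes one on `f⁻¹𝔘`, and its symbol forms
`∧ dlog (σ_J ∘ f)` are the pull-backs `f^*(∧ dlog σ_J)` at the points of `f⁻¹(U_J)`. With the
functoriality of the zig-zag (`IsTransgression.comap`, file `…TransgressionPullback`) and the
naturality of the de Rham comparison of a Hodge model (field `HodgeModel.deRham_isNatural`) this
gives the structural theorem the isogeny-weight line of the kernel rests on
(`Cruxes/SymbolLiftR/Ideas/isogeny-weights-regulator.md`: "`[m]^*` acts on the whole weight-`p`
exponential sequence by PULL-BACK — units pull back, no norm is needed") and the census's S⁺₄(i):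

* `IsHolUnitOn.comp`, `IsGoodTuple.comp`, `mapDomain_mem_milnorRel`,
  `IsMilnorSymbolCocycle.comp` — the Milnor side;
* `ofFun_comp_eq_pullback`, `dlog_comp_apply`, `dlogWedge_comp_apply`,
  `symbolForm_mapDomain_apply` — the symbol forms of the pulled-back chains are the pulled-back
  symbol forms, at the good points;
* `HodgeModel.HasSymbolCocycle.map_endomorphism'` — **for an endomorphism `ψ : X ⟶ X` of a smooth
  projective variety and a Hodge model `A` of `X`, if `c` carries a weight-`(q+1)` symbol cocycle
  on `A` then so does `ψ^* c`** (the symbol classes on `A` are stable under `End(X)^*`; e.g. under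
  the isogenies `[m]^*` of an abelian variety).

References: H. Esnault, E. Viehweg, *Deligne–Beilinson cohomology* (1988), §7 (functoriality of
`dlog`); J.-P. Serre, GAGA (1956), §2 n°5 (`f^an` is holomorphic); R. Bott, L. W. Tu (1982), §I.2,
§8; C. Voisin, *Hodge Theory I* (2002), §7.3.2.

Provenance: Literature home (namespace `Literature.AlgebraicGeometry.HodgeTheory.SymbolCocycles`) of the Summits-side `Theorems/MilnorKExponentialSymbolLiftRSymbolPullback` (route `MilnorKExponential`, crux `SymbolLiftR`; imports = the re-homed `MilnorSymbolCocycleTransgression` ∕ `CechDeRhamTransgressionPullback` + Literature); theorems only, no named fact, no definition; the four dot-notation lemmas carry primed names (unprimed FQNs are the Summits file's) and the packaged `stub_…` statement is kept under a `…_closed` name. Lane `lit-hodgefound` (Layer A1), seat p20.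
-/

noncomputable section

-- `TangentSpace 𝓘(ℝ, E) x = E` is an abuse of definitional equality; let `isDefEq` unfold it.
set_option backward.isDefEq.respectTransparency false

open scoped Manifold _root_.Topology ContDiff
open Set Function Filter

namespace Literature.AlgebraicGeometry.HodgeTheory.SymbolCocycles

open Literature.Geometry.Kaehler.CechDeRham
open Literature.Geometry.Kaehler.MilnorSymbolNaive hiding smoothAt_ofFun_of_mdifferentiableOn

open Literature.Geometry.Kaehler Literature.NumberTheory.Transcendental

section Manifolds

variable {E : Type*} [NormedAddCommGroup E] [NormedSpace ℂ E]
  {M : Type*} [TopologicalSpace M] [ChartedSpace E M]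
  {E' : Type*} [NormedAddCommGroup E'] [NormedSpace ℂ E']
  {N : Type*} [TopologicalSpace N] [ChartedSpace E' N] {p : ℕ}

/-! ### The Milnor side: units, relations and cocycles pull back -/

/-- **Units pull back**: an invertible holomorphic function on `W` composed with a holomorphic map
`f` is an invertible holomorphic function on `f⁻¹(W)`. [cite: EsnaultViehweg1988DB, §7] -/
theorem _root_.Literature.Geometry.Kaehler.IsHolUnitOn.comp' {W : Set M} {g : M → ℂ}
    (hg : IsHolUnitOn E W g) {f : N → M} (hf : MDifferentiable 𝓘(ℂ, E') 𝓘(ℂ, E) f) :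
    IsHolUnitOn E' (f ⁻¹' W) (g ∘ f) :=
  ⟨hg.1.comp hf.mdifferentiableOn (mapsTo_preimage f W), fun y hy ↦ hg.2 (f y) hy⟩

/-- Good tuples pull back to good tuples. [cite: EsnaultViehweg1988DB, §7] -/
theorem _root_.Literature.Geometry.Kaehler.IsGoodTuple.comp' {W : Set M} {t : Fin p → M → ℂ}
    (ht : IsGoodTuple E W t) {f : N → M} (hf : MDifferentiable 𝓘(ℂ, E') 𝓘(ℂ, E) f) :
    IsGoodTuple E' (f ⁻¹' W) (fun i ↦ t i ∘ f) :=
  fun i ↦ (ht i).comp' hf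

omit [TopologicalSpace M] [ChartedSpace E M] [TopologicalSpace N] [ChartedSpace E' N] in
/-- Composition commutes with updating one slot of a tuple. [cite: EsnaultViehweg1988DB, §7] -/
theorem comp_update_tuple (f : N → M) (t : Fin p → M → ℂ) (i : Fin p) (h : M → ℂ) :
    (fun j ↦ update t i h j ∘ f) = update (fun j ↦ t j ∘ f) i (h ∘ f) :=
  Function.comp_update (fun φ : M → ℂ ↦ φ ∘ f) t i h

/-- **The naive Milnor relations pull back**: the chain map `[t] ↦ [t ∘ f]` (`Finsupp.mapDomain`)
sends `milnorRel E W p` into `milnorRel E' (f⁻¹W) p` — each of the three generating families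
(pointwise agreement, multilinearity, Steinberg) is mapped into the same family.
[cite: EsnaultViehweg1988DB, §7] -/
theorem mapDomain_mem_milnorRel {W : Set M} {f : N → M} (hf : MDifferentiable 𝓘(ℂ, E') 𝓘(ℂ, E) f)
    {s : (Fin p → M → ℂ) →₀ ℤ} (hs : s ∈ milnorRel E W p) :
    Finsupp.mapDomain (fun (t : Fin p → M → ℂ) (i : Fin p) ↦ t i ∘ f) s ∈ milnorRel E' (f ⁻¹' W) p := by
  -- work with the additive map `Φ = mapDomain (· ∘ f)`
  set Φ := Finsupp.mapDomain.addMonoidHom (M := ℤ) (fun (t : Fin p → M → ℂ) (i : Fin p) ↦ t i ∘ f)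
    with hΦ
  change Φ s ∈ milnorRel E' (f ⁻¹' W) p
  induction hs using AddSubgroup.closure_induction with
  | mem s h =>
    rcases h with (⟨t, t', ht, ht', he, rfl⟩ | ⟨t, i, g, ht, hg, rfl⟩) | ⟨t, i, j, ht, hij, h1, rfl⟩
    · rw [map_sub, hΦ, Finsupp.mapDomain.addMonoidHom_apply, Finsupp.mapDomain.addMonoidHom_apply,
        Finsupp.mapDomain_single, Finsupp.mapDomain_single]
      exact single_sub_single_mem_milnorRel (ht.comp' hf) (ht'.comp' hf) fun i y hy ↦
        congrArg id (he i (f y) hy)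
    · rw [map_sub, map_sub, hΦ, Finsupp.mapDomain.addMonoidHom_apply,
        Finsupp.mapDomain.addMonoidHom_apply, Finsupp.mapDomain.addMonoidHom_apply,
        Finsupp.mapDomain_single, Finsupp.mapDomain_single, Finsupp.mapDomain_single,
        comp_update_tuple, comp_update_tuple]
      exact multilinear_mem_milnorRel (ht.comp' hf) i (hg.comp' hf)
    · rw [hΦ, Finsupp.mapDomain.addMonoidHom_apply, Finsupp.mapDomain_single]
      exact steinberg_mem_milnorRel (ht.comp' hf) hij fun y hy ↦ h1 (f y) hy
  | zero => rw [map_zero]; exact zero_mem _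
  | add a b _ _ ha hb => rw [map_add]; exact add_mem ha hb
  | neg a _ ha => rw [map_neg]; exact neg_mem ha

/-- **Milnor symbol cocycles pull back**: along a holomorphic `f : N → M`, a Čech cochain of chains
of good tuples on the cover `𝔘` of `M` with differential in the naive relations becomes, entry by
entry composed with `f`, such a cochain on the cover `f⁻¹𝔘` of `N`. [cite: EsnaultViehweg1988DB, §7] -/
theorem _root_.Literature.Geometry.Kaehler.IsMilnorSymbolCocycle.comp' {ι : Type*} {U : ι → Set M}
    {m : ℕ} {σ : (Fin (m + 1) → ι) → ((Fin p → M → ℂ) →₀ ℤ)} (hσ : IsMilnorSymbolCocycle E U σ)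
    {f : N → M} (hf : MDifferentiable 𝓘(ℂ, E') 𝓘(ℂ, E) f) :
    IsMilnorSymbolCocycle E' (fun i ↦ f ⁻¹' U i)
      (fun J ↦ Finsupp.mapDomain (fun (t : Fin p → M → ℂ) (i : Fin p) ↦ t i ∘ f) (σ J)) := by
  classical
  refine ⟨fun J t' ht' ↦ ?_, fun J' ↦ ?_⟩
  · obtain ⟨t, ht, rfl⟩ := Finset.mem_image.1 (Finsupp.mapDomain_support ht')
    rw [cechSet_preimage]
    exact (hσ.good J (Finset.mem_coe.1 ht)).comp' hf
  · have h : symbolδ (fun J ↦ Finsupp.mapDomain (fun (t : Fin p → M → ℂ) (i : Fin p) ↦ t i ∘ f) (σ J)) J' =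
        Finsupp.mapDomain.addMonoidHom (fun (t : Fin p → M → ℂ) (i : Fin p) ↦ t i ∘ f) (symbolδ σ J') := by
      rw [symbolδ, symbolδ, map_sum]
      refine Finset.sum_congr rfl fun j _ ↦ ?_
      rw [map_zsmul]
      rfl
    rw [h, cechSet_preimage]
    exact mapDomain_mem_milnorRel hf (hσ.cocycle J')

/-! ### The symbol forms of the pulled-back chains are the pulled-back symbol forms -/

variable [IsManifold 𝓘(ℝ, E) ∞ M] [IsManifold 𝓘(ℝ, E') ∞ N]

omit [IsManifold 𝓘(ℝ, E) ∞ M] [IsManifold 𝓘(ℝ, E') ∞ N] in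
/-- The `0`-form of `g ∘ f` is the pull-back of the `0`-form of `g`. [cite: EsnaultViehweg1988DB, §7] -/
theorem ofFun_comp_eq_pullback (f : N → M) (g : M → ℂ) :
    (MForm.ofFun 𝓘(ℝ, E') (g ∘ f) : MForm 𝓘(ℝ, E') N ℂ 0) =
      MForm.pullback 𝓘(ℝ, E') f (MForm.ofFun 𝓘(ℝ, E) g : MForm 𝓘(ℝ, E) M ℂ 0) := by
  funext y
  ext v
  rw [MForm.pullback_apply, MForm.ofFun_apply, MForm.ofFun_apply]
  rfl

/-- **`dlog (g ∘ f) = f^*(dlog g)` at a point** near which `f` is `C^∞` and at whose image `g` is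
`C^∞` (naturality of `d` on the `0`-form `g`, `mextDeriv_pullback_apply`).
[cite: EsnaultViehweg1988DB, §7] -/
theorem dlog_comp_apply {f : N → M} {g : M → ℂ} {y : N}
    (hf : ∀ᶠ z in 𝓝 y, ContMDiffAt 𝓘(ℝ, E') 𝓘(ℝ, E) ∞ f z) (hg : (MForm.ofFun 𝓘(ℝ, E) g).SmoothAt (f y)) :
    dlog E' (g ∘ f) y = (dlog E g).pullback 𝓘(ℝ, E') f y := by
  ext v
  rw [dlog_apply, ContinuousAlternatingMap.smul_apply, ofFun_comp_eq_pullback (E := E) f g,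
    mextDeriv_pullback_apply hf hg, MForm.pullback_apply, MForm.pullback_apply, dlog_apply,
    ContinuousAlternatingMap.smul_apply]
  rfl

variable [IsManifold 𝓘(ℂ, E) ω M] [FiniteDimensional ℂ E]

/-- **`∧ dlog (t ∘ f) = f^*(∧ dlog t)` at the points of `f⁻¹(W)`** for a good tuple `t` on an open
`W` and a real `C^∞` map `f` (induction on the weight: `f^*` is multiplicative for `∧`,
`MForm.pullback_wedge`, and `dlog_comp_apply` on each factor, the entries being real `C^∞` on `W`).
[cite: EsnaultViehweg1988DB, §7] -/
theorem dlogWedge_comp_apply {W : Set M} (hW : IsOpen W) {t : Fin p → M → ℂ} (ht : IsGoodTuple E W t)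
    {f : N → M} (hf : ContMDiff 𝓘(ℝ, E') 𝓘(ℝ, E) ∞ f) {y : N} (hy : f y ∈ W) :
    dlogWedge E' p (fun i ↦ t i ∘ f) y = (dlogWedge E p t).pullback 𝓘(ℝ, E') f y := by
  induction p with
  | zero =>
    rw [dlogWedge_zero, dlogWedge_zero, ← ofFun_comp_eq_pullback (E := E) f]
    rfl
  | succ p ih =>
    rw [dlogWedge_succ, dlogWedge_succ, MForm.pullback_wedge, MForm.wedge_apply, MForm.wedge_apply,
      ih (fun i ↦ ht (Fin.castSucc i)),
      dlog_comp_apply (Eventually.of_forall fun z ↦ hf z)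
        (smoothAt_ofFun_of_mdifferentiableOn hW (ht (Fin.last p)).1 hy)]

/-- **The symbol form of the pulled-back chain is the pulled-back symbol form** at the points of
`f⁻¹(W)`, for a chain of good tuples on the open `W`. [cite: EsnaultViehweg1988DB, §7] -/
theorem symbolForm_mapDomain_apply {W : Set M} (hW : IsOpen W) {s : (Fin p → M → ℂ) →₀ ℤ}
    (hs : ∀ t ∈ s.support, IsGoodTuple E W t) {f : N → M} (hf : ContMDiff 𝓘(ℝ, E') 𝓘(ℝ, E) ∞ f)
    {y : N} (hy : f y ∈ W) :
    symbolForm E' p (Finsupp.mapDomain (fun (t : Fin p → M → ℂ) (i : Fin p) ↦ t i ∘ f) s) y =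
      (symbolForm E p s).pullback 𝓘(ℝ, E') f y := by
  -- left: `Σ_t s(t) · ∧dlog(t ∘ f)`; right: `f^*(Σ_t s(t) · ∧dlog t)`
  have hL : symbolForm E' p (Finsupp.mapDomain (fun (t : Fin p → M → ℂ) (i : Fin p) ↦ t i ∘ f) s) =
      ∑ t ∈ s.support, ((s t : ℤ) : ℝ) • dlogWedge E' p (fun i ↦ t i ∘ f) := by
    rw [Finsupp.mapDomain, Finsupp.sum, ← symbolFormHom_apply, map_sum]
    refine Finset.sum_congr rfl fun t _ ↦ ?_
    rw [symbolFormHom_apply, symbolForm_single, Int.cast_smul_eq_zsmul]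
  rw [hL, symbolForm_eq_sum, pullback_sum_smul_apply, Finset.sum_apply]
  refine Finset.sum_congr rfl fun t ht ↦ ?_
  rw [Pi.smul_apply, dlogWedge_comp_apply hW (hs t ht) hf hy]

end Manifolds

/-! ### Symbol cocycles on a Hodge model pull back along endomorphisms of the variety -/

section HodgeModel

open Literature.AlgebraicGeometry Literature.AlgebraicGeometry.HodgeTheory
open Literature.AlgebraicTopology.SingularHomology (singularCohomology)
open _root_.CategoryTheory

variable {n : ℕ} {X : Motives.SchemeOver ℂ}

/-- **Symbol cocycles pull back along endomorphisms.** Let `X` be smooth projective with Hodge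
model `A`, `ψ : X ⟶ X` an endomorphism and `ψ^an : X^an → X^an` the induced holomorphic map
(`HodgeModel.anMap A A ψ`, Serre GAGA §2 n°5). If the class `c ∈ H^{2(q+1)}(X(ℂ); ℂ)` carries a
weight-`(q+1)` Milnor symbol cocycle on `A` (`A.HasSymbolCocycle q c`: cover `𝔘`, cocycle `σ`,
transgression `θ`, `A.deRham [θ] = m • A^* c`), then so does `ψ^* c`: on the cover `(ψ^an)⁻¹𝔘`
take the cocycle `σ ∘ ψ^an` (`IsMilnorSymbolCocycle.comp`), the transgression `(ψ^an)^* θ`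
(`IsTransgression.comap`, re-topped by `symbolForm_mapDomain_apply`), and read the class
through the naturality of `A.deRham` (`HodgeModel.deRham_isNatural`) and
`(ψ^an)^* ∘ A^* = A^* ∘ ψ(ℂ)^*` (`HodgeModel.map_anMap_pullback`). So the classes carrying symbol
cocycles on `A` are stable under `End(X)^*` — e.g. under the isogenies `[m]^*` of an abelian
variety. [cite: EsnaultViehweg1988DB, §7] -/
theorem _root_.Literature.AlgebraicGeometry.HodgeTheory.HodgeModel.HasSymbolCocycle.map_endomorphism'
    (hX : Motives.IsSmoothProjective n X) (A : HodgeModel n X) (ψ : X ⟶ X) {q : ℕ}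
    {c : complexBetti X (2 * (q + 1))} (h : A.HasSymbolCocycle q c) :
    A.HasSymbolCocycle q (complexBetti.map ψ (2 * (q + 1)) c) := by
  obtain ⟨ι, hι, U, hU, hcov, σ, hσ, θ, m, hm, hT, hdR⟩ := h
  set φ : A.carrier → A.carrier := HodgeModel.anMap A A ψ with hφdef
  have hφc : MDifferentiable 𝓘(ℂ, A.model) 𝓘(ℂ, A.model) φ := HodgeModel.mdifferentiable_anMap A A ψ hX hX
  have hφ : ContMDiff 𝓘(ℝ, A.model) 𝓘(ℝ, A.model) ∞ φ := HodgeModel.contMDiff_anMap A A ψ hX hX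
  have hU' : ∀ i, IsOpen (φ ⁻¹' U i) := fun i ↦ (hU i).preimage hφ.continuous
  -- the pulled-back transgression, re-topped on the pulled-back cocycle
  have hT' : IsTransgression hU' q
      (fun J ↦ symbolForm A.model (q + 1)
        (Finsupp.mapDomain (fun (t : Fin (q + 1) → A.carrier → ℂ) (i : Fin (q + 1)) ↦ t i ∘ φ) (σ J)))
      ((θ : MForm 𝓘(ℝ, A.model) A.carrier ℂ (2 * q + 1 + 1)).pullback 𝓘(ℝ, A.model) φ) := by
    refine (hT.comap hφ).of_eqOn_top fun J y hy ↦ ?_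
    have hy' : φ y ∈ cechSet U J := by rwa [cechSet_preimage] at hy
    exact (symbolForm_mapDomain_apply (isOpen_cechSet hU J) (fun t ht ↦ hσ.good J ht) hφ hy').symm
  refine ⟨ι, hι, fun i ↦ φ ⁻¹' U i, hU', fun y ↦ hcov (φ y), _, hσ.comp' hφc,
    ⟨(θ : MForm 𝓘(ℝ, A.model) A.carrier ℂ (2 * q + 1 + 1)).pullback 𝓘(ℝ, A.model) φ,
      pullback_mem_cclosedSmoothForms hφ θ.2⟩, m, hm, hT', ?_⟩
  -- the class: naturality of `A.deRham` and `(ψ^an)^* A^* = A^* ψ^*`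
  rw [← complexDeRhamCohomology.map_mk hφ θ, A.deRham_isNatural A.carrier A.carrier φ hφ _ _, hdR,
    map_smul]
  congr 1
  exact HodgeModel.map_anMap_pullback A A ψ (2 * q + 1 + 1) c

end HodgeModel

/-- Packaged (closed) form `hasSymbolCocycle_map_endomorphism_closed`: `HodgeModel.HasSymbolCocycle.map_endomorphism'`,
stated closed. [cite: EsnaultViehweg1988DB, §7] -/
theorem hasSymbolCocycle_map_endomorphism_closed : ∀ {n : ℕ} {X : Literature.AlgebraicGeometry.Motives.SchemeOver ℂ}, Literature.AlgebraicGeometry.Motives.IsSmoothProjective n X → ∀ (A : Literature.AlgebraicGeometry.HodgeTheory.HodgeModel n X) (ψ : X ⟶ X) {q : ℕ} {c : Literature.AlgebraicGeometry.HodgeTheory.complexBetti X (2 * (q + 1))}, A.HasSymbolCocycle q c → A.HasSymbolCocycle q (Literature.AlgebraicGeometry.HodgeTheory.complexBetti.map ψ (2 * (q + 1)) c) :=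
  fun hX A ψ _ _ h ↦ h.map_endomorphism' hX A ψ

end Literature.AlgebraicGeometry.HodgeTheory.SymbolCocycles

end
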